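import Summits.KontsevichZagierPeriods.KontsevichZagierPeriods.Theses.FurushoPentagon
import Summits.KontsevichZagierPeriods.KontsevichZagierPeriods.Theorems.FurushoPentagonPentagonInKZCornerAssemblyAux2
import Summits.KontsevichZagierPeriods.KontsevichZagierPeriods.Theorems.FurushoPentagonPentagonInKZCornerAssemblyAux3

/-!
# `PentagonInKZ`, line `edge-normal-newton-leibniz`: corner engine — (B) assembly

`stub_cornerPrinciple` of the crux `PentagonInKZ` (stmt-KontsevichZagierPeriods-11348, route
FurushoPentagon) is reduced by the lead's engine to (A) `cornerEngine_uniformlyNull` (dictionary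
of the engine + hypotheses of the principle ⟹ UNIFORM NULLITY in every degree) and (B)
`cornerPrinciple_of_uniformlyNull` (this file; registered hook `cornerPrinciple_assembly`):
dictionary + uniform nullity ⟹ the conclusion `V_α(β) H_0(α) = H_β(α) V_0(β)` at the residues.

Proof of (B). The regularised side integrands `Ht`, `Vt` are good on the closed cube and their
classes in `P_ℚ` are the side classes of the side families (`good_Ht`, `good_Vt`: additivity,
rational scalars, `cls_word` = `simplexToCube` word by word); the defect integrand `F μ` of
bidegree `(k, l)` is good with class `Σ_{U,V} μ(Z_U Z_V) • H^hi_U V^lo_V − μ(Z_V Z_U) • V^hi_V H^lo_U`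
(`cls_F`, Fubini); uniform nullity at `e = 0`, `Ξ ≡ α`, `Η ≡ β`, `σ ≡ 1` says these sum to `0`
over `k + l = n` (`sum_range_defect_eq_zero`); regrouping the square `k, l ≤ N` by total degree
(truncation kills `k + l > N`) gives `defect_sum_eq_zero`; descending along `descendQ χ`
(`descend_sideCls`) and transferring to `DK_N(R)` through `DK_N(R) ↪ R ⊗_ℚ DK_N(ℚ)` tested by
functionals (`dk_sum4_eq`) finishes.
-/

noncomputable section

open Set MeasureTheory
open scoped TensorProduct
open Literature.NumberTheory.Transcendental
open Literature.ModelTheory.ExponentialFields (IsSemialgebraic)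
open Summit.KontsevichZagierPeriods.FurushoPentagon.PentagonInKZNegative

namespace Summit.KontsevichZagierPeriods.FurushoPentagon.PentagonInKZ

namespace CornerAssembly
/-! ### The regularised side integrands, the defect integrand, and uniform nullity at the corner -/

section Defect

variable {m N : ℕ} (cf : Fin (m + 2) → Fin 4 → ℚ) (nZ : Fin (m + 2) → Fin 4 → Fin 4 → ℤ) (α β : ℚ)
  (fd gd : Fin (m + 2) → ℝ → ℝ → ℝ)
  (hfd : ∀ k t y, fd k t y = ((cf k 1 : ℝ) + (cf k 3 : ℝ) * y) /
    ((cf k 0 : ℝ) + (cf k 1 : ℝ) * t + (cf k 2 : ℝ) * y + (cf k 3 : ℝ) * t * y))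
  (hgd : ∀ k x s, gd k x s = ((cf k 2 : ℝ) + (cf k 3 : ℝ) * x) /
    ((cf k 0 : ℝ) + (cf k 1 : ℝ) * x + (cf k 2 : ℝ) * s + (cf k 3 : ℝ) * x * s))
  (qH qV : ∀ {n : ℕ}, (Fin n → Fin (m + 2)) → (Fin n → ℝ) → ℝ → ℝ → ℝ)
  (hqH : ∀ {n : ℕ} (u : Fin n → Fin (m + 2)) (x : Fin n → ℝ) (ξ η : ℝ), qH u x ξ η =
    ∏ i, if u i = 0 then 1 / x i else (ξ * ∏ j ∈ Finset.univ.filter (fun j => j < i), x j) *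
      fd (u i) (ξ * ∏ j ∈ Finset.univ.filter (fun j => j ≤ i), x j) η)
  (hqV : ∀ {n : ℕ} (v : Fin n → Fin (m + 2)) (y : Fin n → ℝ) (ξ η : ℝ), qV v y ξ η =
    ∏ i, if v i = 1 then 1 / y i else (η * ∏ j ∈ Finset.univ.filter (fun j => j < i), y j) *
      gd (v i) ξ (η * ∏ j ∈ Finset.univ.filter (fun j => j ≤ i), y j))
  (Ht Vt : ∀ {n : ℕ}, (Fin n → Fin (m + 2)) → (Fin n → ℝ) → ℝ → ℝ → ℝ)
  (hHt : ∀ {n : ℕ} (U : Fin n → Fin (m + 2)) (x : Fin n → ℝ) (ξ η : ℝ), Ht U x ξ η =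
    ∑ u : Fin n → Fin (m + 2), (Shuffle.regEnd (0 : Fin (m + 2)) (List.ofFn U) (List.ofFn u) : ℝ) *
      qH u x ξ η)
  (hVt : ∀ {n : ℕ} (V : Fin n → Fin (m + 2)) (y : Fin n → ℝ) (ξ η : ℝ), Vt V y ξ η =
    ∑ v : Fin n → Fin (m + 2), (Shuffle.regEnd (1 : Fin (m + 2)) (List.ofFn V) (List.ofFn v) : ℝ) *
      qV v y ξ η)
  (wZ : ∀ {n : ℕ}, (Fin n → Fin (m + 2)) → DrinfeldKohnoTrunc ℚ (Fin 4) N)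
  (hwZ : ∀ {n : ℕ} (U : Fin n → Fin (m + 2)), wZ U =
    ((List.ofFn U).map fun k => ∑ i : Fin 4, ∑ j : Fin 4, (nZ k i j : ℚ) • DrinfeldKohnoTrunc.t ℚ N i j).prod)
  (F : (DrinfeldKohnoTrunc ℚ (Fin 4) N →ₗ[ℚ] ℚ) → ∀ {k l : ℕ}, (Fin k → ℝ) → (Fin l → ℝ) → ℝ → ℝ → ℝ)
  (hF : ∀ (μ : DrinfeldKohnoTrunc ℚ (Fin 4) N →ₗ[ℚ] ℚ) {k l : ℕ} (x : Fin k → ℝ) (y : Fin l → ℝ)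
    (ξ η : ℝ), F μ x y ξ η = ∑ U : Fin k → Fin (m + 2), ∑ V : Fin l → Fin (m + 2),
      ((μ (wZ U * wZ V) : ℝ) * (Ht U x ξ η * Vt V y 0 η) -
        (μ (wZ V * wZ U) : ℝ) * (Vt V y ξ η * Ht U x ξ 0)))
  (h0 : cf 0 = ![0, 1, 0, 0]) (h1 : cf 1 = ![0, 0, 1, 0]) (hα : 0 < α) (hβ : 0 < β)
  (hreg : ∀ k : Fin (m + 2), k ≠ 0 → k ≠ 1 → ∀ x y : ℝ, 0 ≤ x → x ≤ (α : ℝ) → 0 ≤ y → y ≤ (β : ℝ) →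
    (cf k 0 : ℝ) + (cf k 1 : ℝ) * x + (cf k 2 : ℝ) * y + (cf k 3 : ℝ) * x * y ≠ 0)
  (hUN : ∀ n : ℕ, (∀ (μ : DrinfeldKohnoTrunc ℚ (Fin 4) N →ₗ[ℚ] ℚ) (e : ℕ) (Ξ Η σ : (Fin e → ℝ) → ℝ),
    Measurable Ξ → Measurable Η → Measurable σ → IsSemialgebraicFunOn ℚ (KZ.cube e) Ξ →
    IsSemialgebraicFunOn ℚ (KZ.cube e) Η → IsSemialgebraicFunOn ℚ (KZ.cube e) σ →
    (∀ θ ∈ KZ.cube e, 0 ≤ Ξ θ ∧ Ξ θ ≤ (α : ℝ) ∧ 0 ≤ Η θ ∧ Η θ ≤ (β : ℝ)) →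
    (∃ C : ℝ, ∀ θ ∈ KZ.cube e, |σ θ| * Ξ θ * Η θ ≤ C) →
    ∀ (R : (k : Fin (n + 1)) → KZ.IntegralRep ((k : ℕ) + (n - k) + e)),
    (∀ k : Fin (n + 1), (R k).domain = KZ.cube ((k : ℕ) + (n - k) + e) ∧
      Set.EqOn (R k).integrand (fun z => σ (fun s => z (Fin.natAdd ((k : ℕ) + (n - k)) s)) *
        F μ (fun i => z (Fin.castAdd e (Fin.castAdd (n - k) i)))
          (fun j => z (Fin.castAdd e (Fin.natAdd (k : ℕ) j)))
          (Ξ (fun s => z (Fin.natAdd ((k : ℕ) + (n - k)) s)))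
          (Η (fun s => z (Fin.natAdd ((k : ℕ) + (n - k)) s)))) (KZ.cube ((k : ℕ) + (n - k) + e))) →
    ∑ k : Fin (n + 1), KZ.toPeriodAlgebra (KZ.toFormalPeriod (KZ.of (R k))) = 0))
  (IHlo IHhi IVlo IVhi : (w : List (Fin (m + 2))) → KZ.IntegralRep w.length)
  (hIHlo : ∀ w : List (Fin (m + 2)), w.getLast? ≠ some 0 →
    (IHlo w).domain = {t | (∀ i, 0 < t i ∧ t i < (α : ℝ)) ∧ StrictAnti t} ∧
    Set.EqOn (IHlo w).integrand (fun t => ∏ i, fd (w.get i) (t i) 0) (IHlo w).domain)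
  (hIHhi : ∀ w : List (Fin (m + 2)), w.getLast? ≠ some 0 →
    (IHhi w).domain = {t | (∀ i, 0 < t i ∧ t i < (α : ℝ)) ∧ StrictAnti t} ∧
    Set.EqOn (IHhi w).integrand (fun t => ∏ i, fd (w.get i) (t i) (β : ℝ)) (IHhi w).domain)
  (hIVlo : ∀ w : List (Fin (m + 2)), w.getLast? ≠ some 1 →
    (IVlo w).domain = {t | (∀ i, 0 < t i ∧ t i < (β : ℝ)) ∧ StrictAnti t} ∧
    Set.EqOn (IVlo w).integrand (fun t => ∏ i, gd (w.get i) 0 (t i)) (IVlo w).domain)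
  (hIVhi : ∀ w : List (Fin (m + 2)), w.getLast? ≠ some 1 →
    (IVhi w).domain = {t | (∀ i, 0 < t i ∧ t i < (β : ℝ)) ∧ StrictAnti t} ∧
    Set.EqOn (IVhi w).integrand (fun t => ∏ i, gd (w.get i) (α : ℝ) (t i)) (IVhi w).domain)

include hfd hqH hHt h0 h1 hα hreg in
/-- **The regularised horizontal integrand** `x ↦ Ht U (x; α, y)` at a rational height
`y = η₀ ∈ [0, β]` is good on the closed cube, and its class is the SIDE CLASS
`Σ_{u convergent} ⟨regEnd₀ U, u⟩ · χ₀ [IH (ofFn u)]` of any family `IH` of simplex representations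
with integrands `∏ fd (wᵢ) (tᵢ) y` (additivity, rational scalars, and `cls_word` word by word;
words ending in `0` have coefficient `0`). [cite: Drinfeld1991, §2] -/
theorem good_Ht (η₀ : ℚ) (y : ℝ) (hy : (η₀ : ℝ) = y) (hη0 : 0 ≤ η₀) (hη1 : η₀ ≤ β) {k : ℕ}
    (U : Fin k → Fin (m + 2)) :
    (IsSemialgebraicFunOn ℚ (KZ.cube k) (fun x => Ht U x α y) ∧ IntegrableOn (fun x => Ht U x α y) (KZ.cube k)) ∧
    ∀ (IH : (w : List (Fin (m + 2))) → KZ.IntegralRep w.length),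
      (∀ w : List (Fin (m + 2)), w.getLast? ≠ some 0 →
        (IH w).domain = {t | (∀ i, 0 < t i ∧ t i < (α : ℝ)) ∧ StrictAnti t} ∧
        EqOn (IH w).integrand (fun t => ∏ i, fd (w.get i) (t i) y) (IH w).domain) →
      ∀ hg : (IsSemialgebraicFunOn ℚ (KZ.cube k) (fun x => Ht U x α y) ∧ IntegrableOn (fun x => Ht U x α y) (KZ.cube k)),
        chiUniv (KZ.of (KZ.IntegralRep.mk (KZ.cube k) (fun x => Ht U x α y) KZ.isSemialgebraic_cube (And.left hg) (And.right hg))) = (∑ u' ∈ Finset.univ.filter (fun u' : Fin k → _ => (List.ofFn u').getLast? ≠ some (0 : Fin (m + 2))), (Shuffle.regEnd (0 : Fin (m + 2)) (List.ofFn U) (List.ofFn u')) • chiUniv (KZ.of (IH (List.ofFn u')))) := by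
  subst hy
  obtain ⟨M, hM0, hM⟩ := fd_bound cf α β fd hfd h1 hreg η₀ hη0 hη1
  have hc0 : ∀ u : Fin k → Fin (m + 2), (List.ofFn u).getLast? = some 0 →
      Shuffle.regEnd (0 : Fin (m + 2)) (List.ofFn U) (List.ofFn u) = 0 := fun u hu =>
    Finsupp.notMem_support_iff.mp fun hmem => Shuffle.getLast?_ne_of_mem_support_regEnd _ _ hmem hu
  have hgq : ∀ u : Fin k → Fin (m + 2), (List.ofFn u).getLast? ≠ some 0 →
      (IsSemialgebraicFunOn ℚ (KZ.cube k) (fun x => qH u x α η₀) ∧ IntegrableOn (fun x => qH u x α η₀) (KZ.cube k)) := fun u hu =>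
    Q_good (0 : Fin (m + 2)) (fun k => cf k 1 + cf k 3 * η₀) (fun k => cf k 0 + cf k 2 * η₀)
      (fun k t => fd k t η₀) (fd_eq cf fd hfd η₀) (fun u x ξ => qH u x ξ η₀)
      (fun u x ξ => hqH u x ξ _) M α hM0 (by exact_mod_cast hα.le) hM u hu
  have hG : ∀ u : Fin k → Fin (m + 2), (IsSemialgebraicFunOn ℚ (KZ.cube k) (fun x => (Shuffle.regEnd (0 : Fin (m + 2)) (List.ofFn U) (List.ofFn u) : ℝ) * qH u x α η₀) ∧ IntegrableOn (fun x => (Shuffle.regEnd (0 : Fin (m + 2)) (List.ofFn U) (List.ofFn u) : ℝ) * qH u x α η₀) (KZ.cube k)) := by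
    intro u
    by_cases hu : (List.ofFn u).getLast? ≠ some 0
    · exact good_const_mul (hgq u hu) _
    · push Not at hu
      exact good_congr (good_zero k) fun x _ => by simp only [hc0 u hu, Rat.cast_zero, zero_mul]
  have heq : EqOn (fun x => ∑ u : Fin k → Fin (m + 2),
      (Shuffle.regEnd (0 : Fin (m + 2)) (List.ofFn U) (List.ofFn u) : ℝ) * qH u x α η₀)
      (fun x => Ht U x α η₀) (KZ.cube k) := fun x _ => (hHt U x _ _).symm
  refine ⟨good_congr (good_sum _ fun u _ => hG u) heq, fun IH hIH hg => ?_⟩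
  rw [← cls_congr (good_sum _ fun u _ => hG u) hg heq, cls_sum _ hG,
    ← Finset.sum_filter_add_sum_filter_not Finset.univ
      (fun u : Fin k → Fin (m + 2) => (List.ofFn u).getLast? ≠ some 0),
    Finset.sum_eq_zero (s := Finset.univ.filter fun u : Fin k → Fin (m + 2) =>
      ¬ (List.ofFn u).getLast? ≠ some 0) fun u hu => ?_, add_zero]
  · refine Finset.sum_congr rfl fun u hu => ?_
    have hu' : (List.ofFn u).getLast? ≠ some 0 := (Finset.mem_filter.1 hu).2
    rw [cls_const_mul (hgq u hu'), cls_word (0 : Fin (m + 2)) (fun k => cf k 1 + cf k 3 * η₀)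
      (fun k => cf k 0 + cf k 2 * η₀) (fun k t => fd k t η₀) (fd_eq cf fd hfd η₀) (by simp [h0])
      (by simp [h0]) (fun u x ξ => qH u x ξ η₀) (fun u x ξ => hqH u x ξ _) α hα IH hIH u hu'
      (hgq u hu')]
  · have hu' : (List.ofFn u).getLast? = some 0 := by
      simpa using (Finset.mem_filter.1 hu).2
    exact cls_eq_zero_of_eqOn (hG u) fun x _ => by
      simp only [Pi.zero_apply, hc0 u hu', Rat.cast_zero, zero_mul]

include hgd hqV hVt h0 h1 hβ hreg in
/-- **The regularised vertical integrand** `y ↦ Vt V (y; x, β)` at a rational abscissa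
`x = ξ₀ ∈ [0, α]` is good on the closed cube, with class the side class of any family `IV` of
simplex representations with integrands `∏ gd (wᵢ) x (tᵢ)`. [cite: Drinfeld1991, §2] -/
theorem good_Vt (ξ₀ : ℚ) (xr : ℝ) (hx : (ξ₀ : ℝ) = xr) (hξ0 : 0 ≤ ξ₀) (hξ1 : ξ₀ ≤ α) {l : ℕ}
    (V : Fin l → Fin (m + 2)) :
    (IsSemialgebraicFunOn ℚ (KZ.cube l) (fun y => Vt V y xr β) ∧ IntegrableOn (fun y => Vt V y xr β) (KZ.cube l)) ∧
    ∀ (IV : (w : List (Fin (m + 2))) → KZ.IntegralRep w.length),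
      (∀ w : List (Fin (m + 2)), w.getLast? ≠ some 1 →
        (IV w).domain = {t | (∀ i, 0 < t i ∧ t i < (β : ℝ)) ∧ StrictAnti t} ∧
        EqOn (IV w).integrand (fun t => ∏ i, gd (w.get i) xr (t i)) (IV w).domain) →
      ∀ hg : (IsSemialgebraicFunOn ℚ (KZ.cube l) (fun y => Vt V y xr β) ∧ IntegrableOn (fun y => Vt V y xr β) (KZ.cube l)),
        chiUniv (KZ.of (KZ.IntegralRep.mk (KZ.cube l) (fun y => Vt V y xr β) KZ.isSemialgebraic_cube (And.left hg) (And.right hg))) = (∑ u' ∈ Finset.univ.filter (fun u' : Fin l → _ => (List.ofFn u').getLast? ≠ some (1 : Fin (m + 2))), (Shuffle.regEnd (1 : Fin (m + 2)) (List.ofFn V) (List.ofFn u')) • chiUniv (KZ.of (IV (List.ofFn u')))) := by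
  subst hx
  obtain ⟨M, hM0, hM⟩ := gd_bound cf α β gd hgd h0 hreg ξ₀ hξ0 hξ1
  have hc0 : ∀ v : Fin l → Fin (m + 2), (List.ofFn v).getLast? = some 1 →
      Shuffle.regEnd (1 : Fin (m + 2)) (List.ofFn V) (List.ofFn v) = 0 := fun v hv =>
    Finsupp.notMem_support_iff.mp fun hmem => Shuffle.getLast?_ne_of_mem_support_regEnd _ _ hmem hv
  have hgq : ∀ v : Fin l → Fin (m + 2), (List.ofFn v).getLast? ≠ some 1 →
      (IsSemialgebraicFunOn ℚ (KZ.cube l) (fun y => qV v y ξ₀ β) ∧ IntegrableOn (fun y => qV v y ξ₀ β) (KZ.cube l)) := fun v hv =>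
    Q_good (1 : Fin (m + 2)) (fun k => cf k 2 + cf k 3 * ξ₀) (fun k => cf k 0 + cf k 1 * ξ₀)
      (fun k s => gd k ξ₀ s) (gd_eq cf gd hgd ξ₀) (fun v y η => qV v y ξ₀ η)
      (fun v y η => hqV v y _ η) M β hM0 (by exact_mod_cast hβ.le) hM v hv
  have hG : ∀ v : Fin l → Fin (m + 2), (IsSemialgebraicFunOn ℚ (KZ.cube l) (fun y => (Shuffle.regEnd (1 : Fin (m + 2)) (List.ofFn V) (List.ofFn v) : ℝ) * qV v y ξ₀ β) ∧ IntegrableOn (fun y => (Shuffle.regEnd (1 : Fin (m + 2)) (List.ofFn V) (List.ofFn v) : ℝ) * qV v y ξ₀ β) (KZ.cube l)) := by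
    intro v
    by_cases hv : (List.ofFn v).getLast? ≠ some 1
    · exact good_const_mul (hgq v hv) _
    · push Not at hv
      exact good_congr (good_zero l) fun y _ => by simp only [hc0 v hv, Rat.cast_zero, zero_mul]
  have heq : EqOn (fun y => ∑ v : Fin l → Fin (m + 2),
      (Shuffle.regEnd (1 : Fin (m + 2)) (List.ofFn V) (List.ofFn v) : ℝ) * qV v y ξ₀ β)
      (fun y => Vt V y ξ₀ β) (KZ.cube l) := fun y _ => (hVt V y _ _).symm
  refine ⟨good_congr (good_sum _ fun v _ => hG v) heq, fun IV hIV hg => ?_⟩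
  rw [← cls_congr (good_sum _ fun v _ => hG v) hg heq, cls_sum _ hG,
    ← Finset.sum_filter_add_sum_filter_not Finset.univ
      (fun v : Fin l → Fin (m + 2) => (List.ofFn v).getLast? ≠ some 1),
    Finset.sum_eq_zero (s := Finset.univ.filter fun v : Fin l → Fin (m + 2) =>
      ¬ (List.ofFn v).getLast? ≠ some 1) fun v hv => ?_, add_zero]
  · refine Finset.sum_congr rfl fun v hv => ?_
    have hv' : (List.ofFn v).getLast? ≠ some 1 := (Finset.mem_filter.1 hv).2
    rw [cls_const_mul (hgq v hv'), cls_word (1 : Fin (m + 2)) (fun k => cf k 2 + cf k 3 * ξ₀)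
      (fun k => cf k 0 + cf k 1 * ξ₀) (fun k s => gd k ξ₀ s) (gd_eq cf gd hgd ξ₀) (by simp [h1])
      (by simp [h1]) (fun v y η => qV v y ξ₀ η) (fun v y η => hqV v y _ η) β hβ IV hIV v hv'
      (hgq v hv')]
  · have hv' : (List.ofFn v).getLast? = some 1 := by
      simpa using (Finset.mem_filter.1 hv).2
    exact cls_eq_zero_of_eqOn (hG v) fun y _ => by
      simp only [Pi.zero_apply, hc0 v hv', Rat.cast_zero, zero_mul]

include hfd hgd hqH hqV hHt hVt hF h0 h1 hα hβ hreg hIHlo hIHhi hIVlo hIVhi in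
/-- **The defect class in bidegree `(k, l)`**: the integrand `z ↦ F μ (z|_k) (z|^l) α β` on
`[0,1]^{k+l}` is good and its class is, through the side classes of the four side families,
`Σ_{U,V} μ(Z_U Z_V) • H^hi_U V^lo_V − μ(Z_V Z_U) • V^hi_V H^lo_U`. [cite: Drinfeld1991, §2] -/
theorem cls_F (μ : DrinfeldKohnoTrunc ℚ (Fin 4) N →ₗ[ℚ] ℚ) (k l : ℕ) :
    (IsSemialgebraicFunOn ℚ (KZ.cube (k + l)) (fun z => F μ (fun i => z (Fin.castAdd l i)) (fun j => z (Fin.natAdd k j)) α β) ∧ IntegrableOn (fun z => F μ (fun i => z (Fin.castAdd l i)) (fun j => z (Fin.natAdd k j)) α β) (KZ.cube (k + l))) ∧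
    ∀ h : (IsSemialgebraicFunOn ℚ (KZ.cube (k + l)) (fun z => F μ (fun i => z (Fin.castAdd l i)) (fun j => z (Fin.natAdd k j)) α β) ∧ IntegrableOn (fun z => F μ (fun i => z (Fin.castAdd l i)) (fun j => z (Fin.natAdd k j)) α β) (KZ.cube (k + l))),
    chiUniv (KZ.of (KZ.IntegralRep.mk (KZ.cube (k + l)) (fun z => F μ (fun i => z (Fin.castAdd l i)) (fun j => z (Fin.natAdd k j)) α β) KZ.isSemialgebraic_cube (And.left h) (And.right h))) =
      ∑ U : Fin k → Fin (m + 2), ∑ V : Fin l → Fin (m + 2),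
        (μ (wZ U * wZ V) • ((∑ u' ∈ Finset.univ.filter (fun u' : Fin k → _ => (List.ofFn u').getLast? ≠ some (0 : Fin (m + 2))), (Shuffle.regEnd (0 : Fin (m + 2)) (List.ofFn U) (List.ofFn u')) • chiUniv (KZ.of (IHhi (List.ofFn u')))) * (∑ u' ∈ Finset.univ.filter (fun u' : Fin l → _ => (List.ofFn u').getLast? ≠ some (1 : Fin (m + 2))), (Shuffle.regEnd (1 : Fin (m + 2)) (List.ofFn V) (List.ofFn u')) • chiUniv (KZ.of (IVlo (List.ofFn u'))))) -
          μ (wZ V * wZ U) • ((∑ u' ∈ Finset.univ.filter (fun u' : Fin l → _ => (List.ofFn u').getLast? ≠ some (1 : Fin (m + 2))), (Shuffle.regEnd (1 : Fin (m + 2)) (List.ofFn V) (List.ofFn u')) • chiUniv (KZ.of (IVhi (List.ofFn u')))) * (∑ u' ∈ Finset.univ.filter (fun u' : Fin k → _ => (List.ofFn u').getLast? ≠ some (0 : Fin (m + 2))), (Shuffle.regEnd (0 : Fin (m + 2)) (List.ofFn U) (List.ofFn u')) • chiUniv (KZ.of (IHlo (List.ofFn u')))))) := by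
  have tH1 := fun U : Fin k → Fin (m + 2) =>
    good_Ht cf α β fd hfd qH hqH Ht hHt h0 h1 hα hreg β β rfl hβ.le le_rfl U
  have tH0 := fun U : Fin k → Fin (m + 2) =>
    good_Ht cf α β fd hfd qH hqH Ht hHt h0 h1 hα hreg 0 0 Rat.cast_zero le_rfl hβ.le U
  have tV0 := fun V : Fin l → Fin (m + 2) =>
    good_Vt cf α β gd hgd qV hqV Vt hVt h0 h1 hβ hreg 0 0 Rat.cast_zero le_rfl hα.le V
  have tVa := fun V : Fin l → Fin (m + 2) =>
    good_Vt cf α β gd hgd qV hqV Vt hVt h0 h1 hβ hreg α α rfl hα.le le_rfl V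
  have hterm := fun (U : Fin k → Fin (m + 2)) (V : Fin l → Fin (m + 2)) =>
    cls_term (μ (wZ U * wZ V)) (μ (wZ V * wZ U)) (tH1 U).1 (tH0 U).1 (tV0 V).1 (tVa V).1
  have hgood : (IsSemialgebraicFunOn ℚ (KZ.cube (k + l)) (fun z => ∑ U : Fin k → Fin (m + 2), ∑ V : Fin l → Fin (m + 2), ((μ (wZ U * wZ V) : ℝ) * (Ht U (fun i => z (Fin.castAdd l i)) α β * Vt V (fun j => z (Fin.natAdd k j)) 0 β) - (μ (wZ V * wZ U) : ℝ) * (Vt V (fun j => z (Fin.natAdd k j)) α β * Ht U (fun i => z (Fin.castAdd l i)) α 0))) ∧ IntegrableOn (fun z => ∑ U : Fin k → Fin (m + 2), ∑ V : Fin l → Fin (m + 2), ((μ (wZ U * wZ V) : ℝ) * (Ht U (fun i => z (Fin.castAdd l i)) α β * Vt V (fun j => z (Fin.natAdd k j)) 0 β) - (μ (wZ V * wZ U) : ℝ) * (Vt V (fun j => z (Fin.natAdd k j)) α β * Ht U (fun i => z (Fin.castAdd l i)) α 0))) (KZ.cube (k + l))) :=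
    good_sum _ fun U _ => good_sum _ fun V _ => (hterm U V).1
  have heq : EqOn (fun z => ∑ U : Fin k → Fin (m + 2), ∑ V : Fin l → Fin (m + 2),
      ((μ (wZ U * wZ V) : ℝ) * (Ht U (fun i => z (Fin.castAdd l i)) α β *
        Vt V (fun j => z (Fin.natAdd k j)) 0 β) -
      (μ (wZ V * wZ U) : ℝ) * (Vt V (fun j => z (Fin.natAdd k j)) α β *
        Ht U (fun i => z (Fin.castAdd l i)) α 0)))
      (fun z => F μ (fun i => z (Fin.castAdd l i)) (fun j => z (Fin.natAdd k j)) α β)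
      (KZ.cube (k + l)) := fun z _ => (hF μ _ _ _ _).symm
  refine ⟨good_congr hgood heq, fun h => ?_⟩
  rw [← cls_congr hgood h heq, cls_sum _ fun U => good_sum _ fun V _ => (hterm U V).1]
  refine Finset.sum_congr rfl fun U _ => ?_
  rw [cls_sum _ fun V => (hterm U V).1]
  refine Finset.sum_congr rfl fun V _ => ?_
  rw [(hterm U V).2 (hterm U V).1, (tH1 U).2 IHhi hIHhi (tH1 U).1, (tH0 U).2 IHlo hIHlo (tH0 U).1,
    (tV0 V).2 IVlo hIVlo (tV0 V).1, (tVa V).2 IVhi hIVhi (tVa V).1,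
    mul_comm (∑ u' ∈ Finset.univ.filter (fun u' : Fin k → _ => (List.ofFn u').getLast? ≠ some (0 : Fin (m + 2))), (Shuffle.regEnd (0 : Fin (m + 2)) (List.ofFn U) (List.ofFn u')) • chiUniv (KZ.of (IHlo (List.ofFn u'))))]

include hfd hgd hqH hqV hHt hVt hF h0 h1 hα hβ hreg hUN hIHlo hIHhi hIVlo hIVhi in
/-- **Uniform nullity at the corner, degree `n`**: at `e = 0`, `Ξ ≡ α`, `Η ≡ β`, `σ ≡ 1`, uniform
nullity says that the cube classes of the defect integrands `F μ` of the bidegrees `(k, n-k)` sum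
to `0` in `P_ℚ`; through `cls_F` this is an identity between side classes.
[cite: Drinfeld1991, §2] -/
theorem sum_range_defect_eq_zero (μ : DrinfeldKohnoTrunc ℚ (Fin 4) N →ₗ[ℚ] ℚ) (n : ℕ) :
    ∑ k ∈ Finset.range (n + 1), ∑ U : Fin k → Fin (m + 2), ∑ V : Fin (n - k) → Fin (m + 2),
      (μ (wZ U * wZ V) • ((∑ u' ∈ Finset.univ.filter (fun u' : Fin k → _ => (List.ofFn u').getLast? ≠ some (0 : Fin (m + 2))), (Shuffle.regEnd (0 : Fin (m + 2)) (List.ofFn U) (List.ofFn u')) • chiUniv (KZ.of (IHhi (List.ofFn u')))) *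
          (∑ u' ∈ Finset.univ.filter (fun u' : Fin (n - k) → _ => (List.ofFn u').getLast? ≠ some (1 : Fin (m + 2))), (Shuffle.regEnd (1 : Fin (m + 2)) (List.ofFn V) (List.ofFn u')) • chiUniv (KZ.of (IVlo (List.ofFn u'))))) -
        μ (wZ V * wZ U) • ((∑ u' ∈ Finset.univ.filter (fun u' : Fin (n - k) → _ => (List.ofFn u').getLast? ≠ some (1 : Fin (m + 2))), (Shuffle.regEnd (1 : Fin (m + 2)) (List.ofFn V) (List.ofFn u')) • chiUniv (KZ.of (IVhi (List.ofFn u')))) *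
          (∑ u' ∈ Finset.univ.filter (fun u' : Fin k → _ => (List.ofFn u').getLast? ≠ some (0 : Fin (m + 2))), (Shuffle.regEnd (0 : Fin (m + 2)) (List.ofFn U) (List.ofFn u')) • chiUniv (KZ.of (IHlo (List.ofFn u')))))) = 0 := by
  have hcF := fun k : ℕ => cls_F cf α β fd gd hfd hgd qH qV hqH hqV Ht Vt hHt hVt wZ F hF h0 h1 hα
    hβ hreg IHlo IHhi IVlo IVhi hIHlo hIHhi hIVlo hIVhi μ k (n - k)
  have hg : ∀ k : Fin (n + 1), (IsSemialgebraicFunOn ℚ (KZ.cube ((k : ℕ) + (n - k) + 0)) (fun z => (1 : ℝ) * F μ (fun i => z (Fin.castAdd 0 (Fin.castAdd (n - k) i))) (fun j => z (Fin.castAdd 0 (Fin.natAdd (k : ℕ) j))) α β) ∧ IntegrableOn (fun z => (1 : ℝ) * F μ (fun i => z (Fin.castAdd 0 (Fin.castAdd (n - k) i))) (fun j => z (Fin.castAdd 0 (Fin.natAdd (k : ℕ) j))) α β) (KZ.cube ((k : ℕ) + (n - k) + 0))) := fun k =>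
    good_congr (hcF k).1 (fun z _ => by simp only [one_mul]; rfl)
  have h := hUN n μ 0 (fun _ => (α : ℝ)) (fun _ => (β : ℝ)) (fun _ => (1 : ℝ)) measurable_const
    measurable_const measurable_const (isSemialgebraicFunOn_const_ratCast KZ.isSemialgebraic_cube α)
    (isSemialgebraicFunOn_const_ratCast KZ.isSemialgebraic_cube β)
    ((isSemialgebraicFunOn_const_ratCast KZ.isSemialgebraic_cube 1).congr fun _ _ => Rat.cast_one)
    (fun _ _ => ⟨by exact_mod_cast hα.le, le_rfl, by exact_mod_cast hβ.le, le_rfl⟩)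
    ⟨(α : ℝ) * β, fun _ _ => by rw [abs_one, one_mul]⟩
    (fun k => (KZ.IntegralRep.mk (KZ.cube ((k : ℕ) + (n - k) + 0)) (fun z => (1 : ℝ) * F μ (fun i => z (Fin.castAdd 0 (Fin.castAdd (n - k) i))) (fun j => z (Fin.castAdd 0 (Fin.natAdd (k : ℕ) j))) α β) KZ.isSemialgebraic_cube (And.left (hg k)) (And.right (hg k))))
    (fun k => ⟨rfl, fun z _ => rfl⟩)
  rw [Finset.sum_range]
  refine (Finset.sum_congr rfl fun k _ => ?_).trans h
  rw [← chiUniv_apply, ← (hcF k).2 (hcF k).1]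
  exact cls_congr (hcF k).1 (hg k) (fun z _ => by simp only [one_mul]; rfl)

include hfd hgd hqH hqV hHt hVt hwZ hF h0 h1 hα hβ hreg hUN hIHlo hIHhi hIVlo hIVhi in
/-- **All defect sums vanish**: summed over the square of bidegrees `k, l ≤ N`, the side-class
expression of the `μ`-component of `H_β(α) V_0(β) − V_α(β) H_0(α)` is `0` in `P_ℚ` (regroup by
total degree — bidegrees of total degree `> N` contribute `0` by truncation — and apply uniform
nullity degree by degree). [cite: Drinfeld1991, §2] -/
theorem defect_sum_eq_zero (μ : DrinfeldKohnoTrunc ℚ (Fin 4) N →ₗ[ℚ] ℚ) :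
    ∑ k ∈ Finset.range (N + 1), ∑ l ∈ Finset.range (N + 1),
      ∑ U : Fin k → Fin (m + 2), ∑ V : Fin l → Fin (m + 2),
        (μ (wZ U * wZ V) • ((∑ u' ∈ Finset.univ.filter (fun u' : Fin k → _ => (List.ofFn u').getLast? ≠ some (0 : Fin (m + 2))), (Shuffle.regEnd (0 : Fin (m + 2)) (List.ofFn U) (List.ofFn u')) • chiUniv (KZ.of (IHhi (List.ofFn u')))) *
            (∑ u' ∈ Finset.univ.filter (fun u' : Fin l → _ => (List.ofFn u').getLast? ≠ some (1 : Fin (m + 2))), (Shuffle.regEnd (1 : Fin (m + 2)) (List.ofFn V) (List.ofFn u')) • chiUniv (KZ.of (IVlo (List.ofFn u'))))) -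
          μ (wZ V * wZ U) • ((∑ u' ∈ Finset.univ.filter (fun u' : Fin l → _ => (List.ofFn u').getLast? ≠ some (1 : Fin (m + 2))), (Shuffle.regEnd (1 : Fin (m + 2)) (List.ofFn V) (List.ofFn u')) • chiUniv (KZ.of (IVhi (List.ofFn u')))) *
            (∑ u' ∈ Finset.univ.filter (fun u' : Fin k → _ => (List.ofFn u').getLast? ≠ some (0 : Fin (m + 2))), (Shuffle.regEnd (0 : Fin (m + 2)) (List.ofFn U) (List.ofFn u')) • chiUniv (KZ.of (IHlo (List.ofFn u')))))) = 0 := by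
  rw [sum_range_sum_range_eq N (fun k l => ∑ U : Fin k → Fin (m + 2), ∑ V : Fin l → Fin (m + 2),
    (μ (wZ U * wZ V) • ((∑ u' ∈ Finset.univ.filter (fun u' : Fin k → _ => (List.ofFn u').getLast? ≠ some (0 : Fin (m + 2))), (Shuffle.regEnd (0 : Fin (m + 2)) (List.ofFn U) (List.ofFn u')) • chiUniv (KZ.of (IHhi (List.ofFn u')))) *
        (∑ u' ∈ Finset.univ.filter (fun u' : Fin l → _ => (List.ofFn u').getLast? ≠ some (1 : Fin (m + 2))), (Shuffle.regEnd (1 : Fin (m + 2)) (List.ofFn V) (List.ofFn u')) • chiUniv (KZ.of (IVlo (List.ofFn u'))))) -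
      μ (wZ V * wZ U) • ((∑ u' ∈ Finset.univ.filter (fun u' : Fin l → _ => (List.ofFn u').getLast? ≠ some (1 : Fin (m + 2))), (Shuffle.regEnd (1 : Fin (m + 2)) (List.ofFn V) (List.ofFn u')) • chiUniv (KZ.of (IVhi (List.ofFn u')))) *
        (∑ u' ∈ Finset.univ.filter (fun u' : Fin k → _ => (List.ofFn u').getLast? ≠ some (0 : Fin (m + 2))), (Shuffle.regEnd (0 : Fin (m + 2)) (List.ofFn U) (List.ofFn u')) • chiUniv (KZ.of (IHlo (List.ofFn u')))))))
    (fun k l hkl => Finset.sum_eq_zero fun U _ => Finset.sum_eq_zero fun V _ => by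
      rw [wZ_mul_wZ_eq_zero nZ wZ hwZ hkl, wZ_mul_wZ_eq_zero nZ wZ hwZ (by omega) V U, map_zero,
        zero_smul, zero_smul, sub_zero])]
  exact Finset.sum_eq_zero fun n _ => sum_range_defect_eq_zero cf α β fd gd hfd hgd qH qV hqH hqV
    Ht Vt hHt hVt wZ F hF h0 h1 hα hβ hreg hUN IHlo IHhi IVlo IVhi hIHlo hIHhi hIVlo hIVhi μ n

end Defect

end CornerAssembly

open CornerAssembly in
/-- **(B) Assembly**: uniform nullity in every degree gives the corner principle's conclusion.
Uniform nullity at `e = 0`, `Ξ ≡ α`, `Η ≡ β`, `σ ≡ 1` makes the cube classes of the defect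
integrands `F μ` of total degree `n` sum to `0` in `P_ℚ`; expanding them by additivity and Fubini
into side classes, identifying the side classes with the simplex integrals of the side families
(`simplexToCube`, dead words vanish), regrouping the square of bidegrees `k, l ≤ N` by total degree
(truncation kills `k + l > N`), descending along `descendQ χ` and transferring to `DK_N(R)` through
`R ⊗_ℚ DK_N(ℚ)` gives `V_α(β) H_0(α) = H_β(α) V_0(β)` at the residues `Z`.
[cite: Drinfeld1991, §2] -/
theorem cornerPrinciple_of_uniformlyNull :
    ∀ (m N : ℕ) (cf : Fin (m + 2) → Fin 4 → ℚ) (nZ : Fin (m + 2) → Fin 4 → Fin 4 → ℤ) (α β : ℚ) (fd gd : Fin (m + 2) → ℝ → ℝ → ℝ) (hfd : ∀ k t y, fd k t y = ((cf k 1 : ℝ) + (cf k 3 : ℝ) * y) / ((cf k 0 : ℝ) + (cf k 1 : ℝ) * t + (cf k 2 : ℝ) * y + (cf k 3 : ℝ) * t * y)) (hgd : ∀ k x s, gd k x s = ((cf k 2 : ℝ) + (cf k 3 : ℝ) * x) / ((cf k 0 : ℝ) + (cf k 1 : ℝ) * x + (cf k 2 : ℝ) * s + (cf k 3 : ℝ)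 * x * s)) (qH qV : ∀ {n : ℕ}, (Fin n → Fin (m + 2)) → (Fin n → ℝ) → ℝ → ℝ → ℝ) (hqH : ∀ {n : ℕ} (u : Fin n → Fin (m + 2)) (x : Fin n → ℝ) (ξ η : ℝ), qH u x ξ η = ∏ i, if u i = 0 then 1 / x i else (ξ * ∏ j ∈ Finset.univ.filter (fun j => j < i), x j) * fd (u i) (ξ * ∏ j ∈ Finset.univ.filter (fun j => j ≤ i), x j) η) (hqV : ∀ {n : ℕ} (v : Fin n → Fin (m + 2)) (y : Fin n → ℝ) (ξ η : ℝ), qV v y ξ η = ∏ i, if v i = 1 then 1 / y i else (η * ∏ j ∈ Finset.univ.filter (fun j => j < i), y j) * gd (v i) ξ (η * ∏ j ∈ Finset.univ.filter (fun j => j ≤ i), y j)) (Ht Vt : ∀ {n : ℕ}, (Fin n → Fin (m + 2)) → (Fin n → ℝ) → ℝ → ℝ → ℝ) (hHt : ∀ {n : ℕ} (U : Fin n → Fin (m + 2)) (x : Fin n → ℝ) (ξ η : ℝ), Ht U x ξ η = ∑ u : Fin n → Fin (m + 2), (Shuffle.regEnd (0 : Fin (m + 2)) (List.ofFn U) (List.ofFn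 u) : ℝ) * qH u x ξ η) (hVt : ∀ {n : ℕ} (V : Fin n → Fin (m + 2)) (y : Fin n → ℝ) (ξ η : ℝ), Vt V y ξ η = ∑ v : Fin n → Fin (m + 2), (Shuffle.regEnd (1 : Fin (m + 2)) (List.ofFn V) (List.ofFn v) : ℝ) * qV v y ξ η) (wZ : ∀ {n : ℕ}, (Fin n → Fin (m + 2)) → DrinfeldKohnoTrunc ℚ (Fin 4) N) (hwZ : ∀ {n : ℕ} (U : Fin n → Fin (m + 2)), wZ U = ((List.ofFn U).map fun k => ∑ i : Fin 4, ∑ j : Fin 4, (nZ k i j : ℚ) • DrinfeldKohnoTrunc.t ℚ N i j).prod) (F : (DrinfeldKohnoTrunc ℚ (Fin 4) N →ₗ[ℚ] ℚ) → ∀ {k l : ℕ}, (Fin k → ℝ) → (Fin l → ℝ) → ℝ → ℝ → ℝ) (hF : ∀ (μ : DrinfeldKohnoTrunc ℚ (Fin 4) N →ₗ[ℚ] ℚ) {k l : ℕ} (x : Fin k → ℝ) (y : Fin l → ℝ) (ξ η : ℝ), F μ x y ξ η = ∑ U : Fin k → Fin (m + 2), ∑ V : Fin l → Fin (m + 2),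 ((μ (wZ U * wZ V) : ℝ) * (Ht U x ξ η * Vt V y 0 η) - (μ (wZ V * wZ U) : ℝ) * (Vt V y ξ η * Ht U x ξ 0))), cf 0 = ![0, 1, 0, 0] → cf 1 = ![0, 0, 1, 0] → 0 < α → 0 < β → (∀ k : Fin (m + 2), k ≠ 0 → k ≠ 1 → ∀ x y : ℝ, 0 ≤ x → x ≤ (α : ℝ) → 0 ≤ y → y ≤ (β : ℝ) → (cf k 0 : ℝ) + (cf k 1 : ℝ) * x + (cf k 2 : ℝ) * y + (cf k 3 : ℝ) * x * y ≠ 0) → (∀ n : ℕ, (∀ (μ : DrinfeldKohnoTrunc ℚ (Fin 4) N →ₗ[ℚ] ℚ) (e : ℕ) (Ξ Η σ : (Fin e → ℝ) → ℝ), Measurable Ξ → Measurable Η → Measurable σ → IsSemialgebraicFunOn ℚ (KZ.cube e) Ξ → IsSemialgebraicFunOn ℚ (KZ.cube e) Η → IsSemialgebraicFunOn ℚ (KZ.cube e) σ → (∀ θ ∈ KZ.cube e, 0 ≤ Ξ θ ∧ Ξ θ ≤ (α : ℝ) ∧ 0 ≤ Η θ ∧ Η θ ≤ (β : ℝ)) →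 (∃ C : ℝ, ∀ θ ∈ KZ.cube e, |σ θ| * Ξ θ * Η θ ≤ C) → ∀ (R : (k : Fin (n + 1)) → KZ.IntegralRep ((k : ℕ) + (n - k) + e)), (∀ k : Fin (n + 1), (R k).domain = KZ.cube ((k : ℕ) + (n - k) + e) ∧ Set.EqOn (R k).integrand (fun z => σ (fun s => z (Fin.natAdd ((k : ℕ) + (n - k)) s)) * F μ (fun i => z (Fin.castAdd e (Fin.castAdd (n - k) i))) (fun j => z (Fin.castAdd e (Fin.natAdd (k : ℕ) j))) (Ξ (fun s => z (Fin.natAdd ((k : ℕ) + (n - k)) s))) (Η (fun s => z (Fin.natAdd ((k : ℕ) + (n - k)) s)))) (KZ.cube ((k : ℕ) + (n - k) + e))) → ∑ k : Fin (n + 1), KZ.toPeriodAlgebra (KZ.toFormalPeriod (KZ.of (R k))) = 0)) → ∀ (R : Type) [CommRing R] [Algebra ℚ R] (χ : KZ.FormalRep →+ R), (∀ c ∈ KZ.relations, χ c = 0) → (∀ x y : KZ.FormalRep, χ (x * y) = χ x * χ y) → (∃ u : KZ.FormalRep, χ u = 1) → ∀ (IHlo IHhi IVlo IVhi : (w : List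 (Fin (m + 2))) → KZ.IntegralRep w.length), (∀ w : List (Fin (m + 2)), w.getLast? ≠ some 0 → (IHlo w).domain = {t | (∀ i, 0 < t i ∧ t i < (α : ℝ)) ∧ StrictAnti t} ∧ Set.EqOn (IHlo w).integrand (fun t => ∏ i, fd (w.get i) (t i) 0) (IHlo w).domain) → (∀ w : List (Fin (m + 2)), w.getLast? ≠ some 0 → (IHhi w).domain = {t | (∀ i, 0 < t i ∧ t i < (α : ℝ)) ∧ StrictAnti t} ∧ Set.EqOn (IHhi w).integrand (fun t => ∏ i, fd (w.get i) (t i) (β : ℝ)) (IHhi w).domain) → (∀ w : List (Fin (m + 2)), w.getLast? ≠ some 1 → (IVlo w).domain = {t | (∀ i, 0 < t i ∧ t i < (β : ℝ)) ∧ StrictAnti t} ∧ Set.EqOn (IVlo w).integrand (fun t => ∏ i, gd (w.get i) 0 (t i)) (IVlo w).domain) → (∀ w : List (Fin (m + 2)), w.getLast? ≠ some 1 → (IVhi w).domain = {t | (∀ i, 0 < t i ∧ t i < (β : ℝ)) ∧ StrictAnti t} ∧ Set.EqOn (IVhi w).integrand (fun t => ∏ i, gd (w.get i) (α : ℝ)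 (t i)) (IVhi w).domain) → ∀ (PHlo PHhi PVlo PVhi : NCSeries (Fin (m + 2)) R), (∀ W, PHlo W = if W = [] then 1 else Shuffle.pair (fun w => χ (KZ.of (IHlo w))) (Shuffle.regEnd 0 W)) → (∀ W, PHhi W = if W = [] then 1 else Shuffle.pair (fun w => χ (KZ.of (IHhi w))) (Shuffle.regEnd 0 W)) → (∀ W, PVlo W = if W = [] then 1 else Shuffle.pair (fun w => χ (KZ.of (IVlo w))) (Shuffle.regEnd 1 W)) → (∀ W, PVhi W = if W = [] then 1 else Shuffle.pair (fun w => χ (KZ.of (IVhi w))) (Shuffle.regEnd 1 W)) → ∀ (Z : Fin (m + 2) → DrinfeldKohnoTrunc R (Fin 4) N), (∀ k, Z k = ∑ i : Fin 4, ∑ j : Fin 4, (nZ k i j : R) • DrinfeldKohnoTrunc.t R N i j) → NCSeries.evalTrunc N Z PVhi * NCSeries.evalTrunc N Z PHlo = NCSeries.evalTrunc N Z PHhi * NCSeries.evalTrunc N Z PVlo := by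
  intro m N cf nZ α β fd gd hfd hgd qH qV hqH hqV Ht Vt hHt hVt wZ hwZ F hF h0 h1 hα hβ hreg hUN R _ _ χ
    hrel hmul hunit IHlo IHhi IVlo IVhi hIHlo hIHhi hIVlo hIVhi PHlo PHhi PVlo PVhi hPHlo hPHhi hPVlo
    hPVhi Z hZ
  classical
  have hχ : IsRealisation R χ := ⟨hrel, hmul, hunit⟩
  -- the residues are the base changes of the rational residue monomials
  have hprod : ∀ {n : ℕ} (f : Fin n → Fin (m + 2)),
      ((List.ofFn f).map Z).prod = DrinfeldKohnoTrunc.map (algebraMap ℚ R) (wZ f) := by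
    intro n f
    rw [hwZ, map_list_prod, List.map_map]
    congr 1
    refine List.map_congr_left fun k _ => ?_
    rw [Function.comp_apply, hZ k, map_sum]
    refine Finset.sum_congr rfl fun i _ => ?_
    rw [map_sum]
    refine Finset.sum_congr rfl fun j _ => ?_
    rw [DrinfeldKohnoTrunc.map_smul, DrinfeldKohnoTrunc.map_t, map_intCast]
  -- the side series descend from the side classes
  have dHlo : ∀ (k : ℕ) (U : Fin k → Fin (m + 2)),
      PHlo (List.ofFn U) = descendQ χ hχ (∑ u' ∈ Finset.univ.filter (fun u' : Fin k → _ => (List.ofFn u').getLast? ≠ some (0 : Fin (m + 2))), (Shuffle.regEnd (0 : Fin (m + 2)) (List.ofFn U) (List.ofFn u')) • chiUniv (KZ.of (IHlo (List.ofFn u')))) := fun k U =>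
    descend_sideCls χ hχ 0 IHlo (of_nil_sub_unit_mem IHlo α
      (fun i t => fd (([] : List (Fin (m + 2))).get i) t 0) (hIHlo [] (by simp))) PHlo hPHlo U
  have dHhi : ∀ (k : ℕ) (U : Fin k → Fin (m + 2)),
      PHhi (List.ofFn U) = descendQ χ hχ (∑ u' ∈ Finset.univ.filter (fun u' : Fin k → _ => (List.ofFn u').getLast? ≠ some (0 : Fin (m + 2))), (Shuffle.regEnd (0 : Fin (m + 2)) (List.ofFn U) (List.ofFn u')) • chiUniv (KZ.of (IHhi (List.ofFn u')))) := fun k U =>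
    descend_sideCls χ hχ 0 IHhi (of_nil_sub_unit_mem IHhi α
      (fun i t => fd (([] : List (Fin (m + 2))).get i) t β) (hIHhi [] (by simp))) PHhi hPHhi U
  have dVlo : ∀ (l : ℕ) (V : Fin l → Fin (m + 2)),
      PVlo (List.ofFn V) = descendQ χ hχ (∑ u' ∈ Finset.univ.filter (fun u' : Fin l → _ => (List.ofFn u').getLast? ≠ some (1 : Fin (m + 2))), (Shuffle.regEnd (1 : Fin (m + 2)) (List.ofFn V) (List.ofFn u')) • chiUniv (KZ.of (IVlo (List.ofFn u')))) := fun l V =>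
    descend_sideCls χ hχ 1 IVlo (of_nil_sub_unit_mem IVlo β
      (fun i t => gd (([] : List (Fin (m + 2))).get i) 0 t) (hIVlo [] (by simp))) PVlo hPVlo V
  have dVhi : ∀ (l : ℕ) (V : Fin l → Fin (m + 2)),
      PVhi (List.ofFn V) = descendQ χ hχ (∑ u' ∈ Finset.univ.filter (fun u' : Fin l → _ => (List.ofFn u').getLast? ≠ some (1 : Fin (m + 2))), (Shuffle.regEnd (1 : Fin (m + 2)) (List.ofFn V) (List.ofFn u')) • chiUniv (KZ.of (IVhi (List.ofFn u')))) := fun l V =>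
    descend_sideCls χ hχ 1 IVhi (of_nil_sub_unit_mem IVhi β
      (fun i t => gd (([] : List (Fin (m + 2))).get i) α t) (hIVhi [] (by simp))) PVhi hPVhi V
  -- bidegree reordering `(l, k, V, U) ↦ (k, l, U, V)`
  have hswap : ∀ f : ∀ k l : ℕ, (Fin k → Fin (m + 2)) → (Fin l → Fin (m + 2)) → R,
      ∑ l ∈ Finset.range (N + 1), ∑ k ∈ Finset.range (N + 1),
        ∑ V : Fin l → Fin (m + 2), ∑ U : Fin k → Fin (m + 2), f k l U V =
      ∑ k ∈ Finset.range (N + 1), ∑ l ∈ Finset.range (N + 1),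
        ∑ U : Fin k → Fin (m + 2), ∑ V : Fin l → Fin (m + 2), f k l U V := by
    intro f
    rw [Finset.sum_comm]
    exact Finset.sum_congr rfl fun k _ => Finset.sum_congr rfl fun l _ => Finset.sum_comm
  -- expand both products and transfer to `R ⊗ DK_N(ℚ)`
  rw [evalTrunc_mul_evalTrunc Z wZ hprod PVhi PHlo, evalTrunc_mul_evalTrunc Z wZ hprod PHhi PVlo]
  refine dk_sum4_eq (N + 1) (fun k l U V => PVhi (List.ofFn U) * PHlo (List.ofFn V))
    (fun k l U V => PHhi (List.ofFn U) * PVlo (List.ofFn V)) (fun k l U V => wZ U * wZ V)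
    (fun k l U V => wZ U * wZ V) fun μ => ?_
  -- the defect sums vanish in `P_ℚ`; descend along `χ`
  have h := congrArg (descendQ χ hχ) (defect_sum_eq_zero cf nZ α β fd gd hfd hgd qH qV hqH hqV Ht Vt
    hHt hVt wZ hwZ F hF h0 h1 hα hβ hreg hUN IHlo IHhi IVlo IVhi hIHlo hIHhi hIVlo hIVhi μ)
  rw [map_zero] at h
  simp only [map_sum, map_sub, map_smul, map_mul, ← dHlo, ← dHhi, ← dVlo, ← dVhi,
    Finset.sum_sub_distrib] at h
  simp only [Finset.sum_sub_distrib]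
  rw [sub_eq_zero] at h ⊢
  rw [← hswap fun k l U V => μ (wZ U * wZ V) • (PVhi (List.ofFn U) * PHlo (List.ofFn V))]
  exact h.symm


/-- **Hook `cornerPrinciple_assembly`** (the gate's registered spelling of (B), registry length limit):
the same proposition as `cornerPrinciple_of_uniformlyNull`, compactly written. [cite: Drinfeld1991, §2] -/
theorem cornerPrinciple_assembly :
    ∀ (m N:ℕ) (cf:Fin (m+2)→Fin 4→ℚ) (nZ:Fin (m+2)→Fin 4→Fin 4→ℤ) (α β:ℚ) (fd gd:Fin (m+2)→ℝ→ℝ→ℝ) (hfd:∀ k t y, fd k t y=((cf k 1:ℝ)+(cf k 3:ℝ)*y) / ((cf k 0:ℝ)+(cf k 1:ℝ)*t+(cf k 2:ℝ)*y+(cf k 3:ℝ)*t*y)) (hgd:∀ k x s, gd k x s=((cf k 2:ℝ)+(cf k 3:ℝ)*x) / ((cf k 0:ℝ)+(cf k 1:ℝ)*x+(cf k 2:ℝ)*s+(cf k 3:ℝ)*x*s)) (qH qV:∀ {n:ℕ}, (Fin n→Fin (m+2))→(Fin n→ℝ)→ℝ→ℝ→ℝ) (hqH:∀ {n:ℕ}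 (u:Fin n→Fin (m+2)) (x:Fin n→ℝ) (ξ η:ℝ), qH u x ξ η=∏ i, if u i=0 then 1 / x i else (ξ*∏ j ∈ Finset.univ.filter (· < i), x j)*fd (u i) (ξ*∏ j ∈ Finset.univ.filter (· ≤ i), x j) η) (hqV:∀ {n:ℕ} (v:Fin n→Fin (m+2)) (y:Fin n→ℝ) (ξ η:ℝ), qV v y ξ η=∏ i, if v i=1 then 1 / y i else (η*∏ j ∈ Finset.univ.filter (· < i), y j)*gd (v i) ξ (η*∏ j ∈ Finset.univ.filter (· ≤ i), y j)) (Ht Vt:∀ {n:ℕ}, (Fin n→Fin (m+2))→(Fin n→ℝ)→ℝ→ℝ→ℝ) (hHt:∀ {n:ℕ} (U:Fin n→Fin (m+2)) (x:Fin n→ℝ) (ξ η:ℝ), Ht U x ξ η=∑ u, (Shuffle.regEnd 0 (List.ofFn U) (List.ofFn u):ℝ)*qH u x ξ η) (hVt:∀ {n:ℕ} (V:Fin n→Fin (m+2)) (y:Fin n→ℝ) (ξ η:ℝ), Vt V y ξ η=∑ v, (Shuffle.regEnd 1 (List.ofFn V) (List.ofFn v):ℝ)*qV v y ξ η) (wZ:∀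 {n:ℕ}, (Fin n→Fin (m+2))→DrinfeldKohnoTrunc ℚ (Fin 4) N) (hwZ:∀ {n:ℕ} (U:Fin n→Fin (m+2)), wZ U=((List.ofFn U).map fun k=>∑ i, ∑ j, (nZ k i j:ℚ)•DrinfeldKohnoTrunc.t ℚ N i j).prod) (F:(DrinfeldKohnoTrunc ℚ (Fin 4) N →ₗ[ℚ] ℚ)→∀ {k l:ℕ}, (Fin k→ℝ)→(Fin l→ℝ)→ℝ→ℝ→ℝ) (hF:∀ μ {k l:ℕ} (x:Fin k→ℝ) (y:Fin l→ℝ) (ξ η:ℝ), F μ x y ξ η=∑ U:Fin k→Fin (m+2), ∑ V:Fin l→Fin (m+2), ((μ (wZ U*wZ V):ℝ)*(Ht U x ξ η*Vt V y 0 η)-(μ (wZ V*wZ U):ℝ)*(Vt V y ξ η*Ht U x ξ 0))), cf 0=![0, 1, 0, 0]→cf 1=![0, 0, 1, 0]→0<α→0<β→(∀ k, k≠0→k≠1→∀ x y:ℝ, 0≤x→x≤(α:ℝ)→0≤y→y≤(β:ℝ)→(cf k 0:ℝ)+cf k 1*x+cf k 2*y+cf k 3*x*y≠0)→(∀ n:ℕ,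 (∀ μ e (Ξ Η σ:(Fin e→ℝ)→ℝ), Measurable Ξ→Measurable Η→Measurable σ→IsSemialgebraicFunOn ℚ (KZ.cube e) Ξ→IsSemialgebraicFunOn ℚ (KZ.cube e) Η→IsSemialgebraicFunOn ℚ (KZ.cube e) σ→(∀ θ ∈ KZ.cube e, 0≤Ξ θ∧Ξ θ≤(α:ℝ)∧0≤Η θ∧Η θ≤(β:ℝ))→(∃ C:ℝ, ∀ θ ∈ KZ.cube e, |σ θ| * Ξ θ * Η θ≤C)→∀ (R:(k:Fin (n+1))→KZ.IntegralRep ((k:ℕ)+(n-k)+e)), (∀ k:Fin (n+1), (R k).domain=KZ.cube ((k:ℕ)+(n-k)+e)∧Set.EqOn (R k).integrand (fun z=>σ (fun s=>z (Fin.natAdd ((k:ℕ)+(n-k)) s))*F μ (fun i=>z (Fin.castAdd e (Fin.castAdd (n-k) i))) (fun j=>z (Fin.castAdd e (Fin.natAdd (k:ℕ) j))) (Ξ (fun s=>z (Fin.natAdd ((k:ℕ)+(n-k)) s))) (Η (fun s=>z (Fin.natAdd ((k:ℕ)+(n-k)) s)))) (KZ.cube ((k:ℕ)+(n-k)+e)))→∑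 k:Fin (n+1), KZ.toPeriodAlgebra (KZ.toFormalPeriod (KZ.of (R k)))=0))→∀ (R:Type) [CommRing R][Algebra ℚ R] (χ:KZ.FormalRep →+ R), (∀ c ∈ KZ.relations, χ c=0)→(∀ x y, χ (x*y)=χ x*χ y)→(∃ u, χ u=1)→∀ (IHlo IHhi IVlo IVhi:(w:List (Fin (m+2)))→KZ.IntegralRep w.length), (∀ w, w.getLast?≠some 0→(IHlo w).domain={t | (∀ i, 0<t i∧t i<(α:ℝ))∧StrictAnti t}∧Set.EqOn (IHlo w).integrand (fun t=>∏ i, fd (w.get i) (t i) 0) (IHlo w).domain)→(∀ w, w.getLast?≠some 0→(IHhi w).domain={t | (∀ i, 0<t i∧t i<(α:ℝ))∧StrictAnti t}∧Set.EqOn (IHhi w).integrand (fun t=>∏ i, fd (w.get i) (t i) (β:ℝ)) (IHhi w).domain)→(∀ w, w.getLast?≠some 1→(IVlo w).domain={t | (∀ i, 0<t i∧t i<(β:ℝ))∧StrictAnti t}∧Set.EqOn (IVlo w).integrand (fun t=>∏ i, gd (w.get i) 0 (t i)) (IVlo w).domain)→(∀ w, w.getLast?≠some 1→(IVhi w).domain={t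 | (∀ i, 0<t i∧t i<(β:ℝ))∧StrictAnti t}∧Set.EqOn (IVhi w).integrand (fun t=>∏ i, gd (w.get i) (α:ℝ) (t i)) (IVhi w).domain)→∀ PHlo PHhi PVlo PVhi:NCSeries (Fin (m+2)) R, (∀ W, PHlo W=if W=[] then 1 else Shuffle.pair (fun w=>χ (KZ.of (IHlo w))) (Shuffle.regEnd 0 W))→(∀ W, PHhi W=if W=[] then 1 else Shuffle.pair (fun w=>χ (KZ.of (IHhi w))) (Shuffle.regEnd 0 W))→(∀ W, PVlo W=if W=[] then 1 else Shuffle.pair (fun w=>χ (KZ.of (IVlo w))) (Shuffle.regEnd 1 W))→(∀ W, PVhi W=if W=[] then 1 else Shuffle.pair (fun w=>χ (KZ.of (IVhi w))) (Shuffle.regEnd 1 W))→∀ Z, (∀ k, Z k=∑ i, ∑ j, (nZ k i j:R)•DrinfeldKohnoTrunc.t R N i j)→NCSeries.evalTrunc N Z PVhi*NCSeries.evalTrunc N Z PHlo=NCSeries.evalTrunc N Z PHhi*NCSeries.evalTrunc N Z PVlo :=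
  cornerPrinciple_of_uniformlyNull

end Summit.KontsevichZagierPeriods.FurushoPentagon.PentagonInKZ
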